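import Literature.AlgebraicTopology.CharacteristicClasses.LineChernClass
import Literature.AlgebraicTopology.CharacteristicClasses.ThomClassMultiples
import Literature.AlgebraicTopology.CharacteristicClasses.ProjectiveCompletionParts
import Literature.AlgebraicTopology.CharacteristicClasses.TautologicalPunctured
import Literature.AlgebraicTopology.SingularHomology.PuncturedPlaneCohomology
import Literature.AlgebraicTopology.SingularHomology.CohomologyMayerVietorisExtend
import Literature.AlgebraicTopology.SingularHomology.SuspensionIsomorphism
import Mathlib.Analysis.Convex.Contractible
import HarnessLib

/-!
# Axiom (C₃): `c₁(γ¹)` generates `H²(ℂP¹; ℤ)`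

D. Husemoller, *Fibre Bundles* (3rd ed. 1994), Ch. 17 §3 (3.2) / Def. 2.6 and J. Milnor, J. Stasheff,
*Characteristic Classes* (1974), §14 Thm. 14.4 (`H*(ℂPⁿ) = ℤ[c₁(γ¹)]/…`, proof p. 160 by the Gysin
sequence with `E₀(γ¹) = ℂⁿ⁺¹ ∖ 0`): for the tautological line bundle `γ¹` over
`ℂP¹ = OnePoint ℂ`, **the first Chern class `c₁(γ¹)` (the Euler class of `LineChernClass`)
generates `H²(ℂP¹; ℤ)`** (`span_firstChernClass_tautological`). The proof, on the projective
completion `D = P(γ¹ ⊕ ℂ)` with its Thom class `t`: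

* (surjectivity, Milnor–Stasheff §12 via Mayer–Vietoris instead of the Gysin sequence) every
  `g ∈ H²(ℂP¹)` is `s₀^* x` for a class `x ∈ H²(D)` with `s_∞^* x = 0`: glue `π^* g` on the
  finite part `D ∖ s_∞ ⊇ s₀` with `0` on the vector part `D ∖ s₀ ⊇ s_∞`
  (`CohomologyMayerVietorisExtend.exists_of_map_inclusion_eq`); the two agree on the overlap
  `≅ E₀(γ¹) ≅ ℂ² ∖ 0` because `H²(ℂ² ∖ 0; ℤ) = 0` (`ProjectiveCompletionParts.puncturedHomeomorph`,
  `TautologicalPunctured.tautPuncturedHomeomorph`, `PuncturedPlaneCohomology`);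
* (multiples of `t`) `x = t(k) = k • t(1)` for some `k ∈ ℤ`, since `ℂP¹` is covered by the two
  contractible charts `{[t : 1]} ≅ ℂ`, `{[1 : s]} ≅ ℂ` (`ThomClassMultiples.exists_eq_thomClass_of_two_charts`);
* hence `g = s₀^* x = k • e(γ¹) = k • c₁(γ¹)`.

Everything is proved; no named facts.

## References

* D. Husemoller, *Fibre Bundles*, GTM 20, Springer 1994, Ch. 17 §3 (3.2), Def. 2.6. [HusemollerFibreBundles1994]
* J. Milnor, J. Stasheff, *Characteristic Classes*, PUP 1974, §12, §14 Thm. 14.4. [MilnorStasheff1974]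
-/

noncomputable section

open CategoryTheory CategoryTheory.Limits Function Set Filter Bundle Topology
  Literature.AlgebraicTopology.SingularHomology
open scoped LinearAlgebra.Projectivization OnePoint

namespace Literature.AlgebraicTopology.CharacteristicClasses

open ComplexVectorBundle ProjectiveLineChart

/-! ### The two contractible charts of `ℂP¹ = OnePoint ℂ` -/

/-- The affine chart `{[t : 1]} = range coe ≃ₜ ℂ`. [folklore] -/
def finiteChartHomeomorph : ↥(range ((↑) : ℂ → OnePoint ℂ)) ≃ₜ ℂ :=
  (OnePoint.isOpenEmbedding_coe (X := ℂ)).isEmbedding.toHomeomorph.symm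

/-- `lineOf (1, s) ≠ [0 : 1]`. [folklore] -/
theorem lineOf_one_ne_zero (s : ℂ) : lineOf (1, s) ≠ ((0 : ℂ) : OnePoint ℂ) := by
  by_cases h : s = 0
  · rw [lineOf_of_eq (q := ((1 : ℂ), s)) h]
    exact OnePoint.infty_ne_coe 0
  · rw [lineOf_of_ne (q := ((1 : ℂ), s)) h, Ne, OnePoint.coe_eq_coe]
    exact div_ne_zero one_ne_zero h

/-- The chart at infinity `{[1 : s]} = {x ≠ [0 : 1]} ≃ₜ ℂ`, `x ↦ 1/x`. [folklore] -/
def infiniteChartHomeomorph : ↥{x : OnePoint ℂ | x ≠ ((0 : ℂ) : OnePoint ℂ)} ≃ₜ ℂ where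
  toFun x := invCoord x.1
  invFun s := ⟨lineOf (1, s), lineOf_one_ne_zero s⟩
  left_inv x := by
    obtain ⟨x, hx⟩ := x
    apply Subtype.ext
    induction x using OnePoint.rec with
    | infty => exact lineOf_of_eq (q := ((1 : ℂ), (0 : ℂ))) rfl
    | coe t =>
      have ht : t ≠ 0 := fun h ↦ hx (by rw [h])
      change lineOf (1, t⁻¹) = (t : OnePoint ℂ)
      rw [lineOf_of_ne (q := ((1 : ℂ), t⁻¹)) (inv_ne_zero ht)]
      change (((1 : ℂ) / t⁻¹ : ℂ) : OnePoint ℂ) = (t : OnePoint ℂ)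
      rw [div_inv_eq_mul, one_mul]
  right_inv s := by
    by_cases h : s = 0
    · change invCoord (lineOf (1, s)) = s
      rw [lineOf_of_eq (q := ((1 : ℂ), s)) h, h]
      rfl
    · change invCoord (lineOf (1, s)) = s
      rw [lineOf_of_ne (q := ((1 : ℂ), s)) h]
      change ((1 : ℂ) / s)⁻¹ = s
      rw [one_div, inv_inv]
  continuous_toFun := by
    have h := continuousOn_invCoord
    rw [continuousOn_iff_continuous_restrict] at h
    exact h
  continuous_invFun := by
    refine Continuous.subtype_mk (continuous_iff_continuousAt.2 fun s ↦ ?_) _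
    exact (continuousAt_lineOf (q₀ := ((1 : ℂ), s)) (by simp)).comp (continuousAt_const.prodMk continuousAt_id)

/-- The finite chart `ℂ ⊆ ℂP¹` is contractible. [folklore] -/
instance : ContractibleSpace ↥(range ((↑) : ℂ → OnePoint ℂ)) := finiteChartHomeomorph.contractibleSpace

/-- The chart `ℂP¹ ∖ {0}` at infinity is contractible. [folklore] -/
instance : ContractibleSpace ↥{x : OnePoint ℂ | x ≠ ((0 : ℂ) : OnePoint ℂ)} :=
  infiniteChartHomeomorph.contractibleSpace

/-! ### The datum: `γ¹`, its completion, the two parts -/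

/-- Short name for the model fibre `ℂ` of `γ¹`. [folklore] -/
abbrev γF : Type := tautologicalLineBundle.F
/-- Short name for the fibres of `γ¹`. [folklore] -/
abbrev γE : OnePoint ℂ → Type := tautologicalLineBundle.E

/-- `γ¹` is a line bundle (model fibre of rank one). [folklore] -/
theorem γ_finrank : Module.finrank ℂ γF = 1 := tautologicalLineBundle.finrank_eq_one_of_rank rank_tautologicalLineBundle

/-- **`H²` of the overlap `finitePart ∩ vectorPart ≅ E₀(γ¹) ≅ ℂ² ∖ 0` vanishes.** [cite: MilnorStasheff1974, §14 p. 160] -/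
theorem isZero_singularCohomology_parts_inter :
    IsZero (singularCohomology ℤ ℤ ↥(finitePart γF γE ∩ vectorPart γF γE) 2) := by
  let e : {q : ℂ × ℂ // q ≠ 0} ≃ₜ ↥(finitePart γF γE ∩ vectorPart γF γE) :=
    tautPuncturedHomeomorph.symm.trans (puncturedHomeomorph γF γE)
  exact (isZero_singularCohomology_puncturedPlane_two ℤ).of_iso (singularCohomology.mapIso ℤ ℤ e 2)

/-- **Surjectivity step**: every `g ∈ H²(ℂP¹; ℤ)` is `s₀^* x` for some `x ∈ H²(P(γ¹ ⊕ ℂ); ℤ)` with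
`s_∞^* x = 0` (Mayer–Vietoris gluing of `π^* g` on the finite part with `0` on the vector part).
[cite: MilnorStasheff1974, §12 Thm. 12.2] -/
theorem exists_map_complZero_eq (g : singularCohomology ℤ ℤ (OnePoint ℂ) 2) :
    ∃ x : singularCohomology ℤ ℤ (ProjCompl γF γE) 2,
      singularCohomology.map ℤ ℤ (complInf γF γE γ_finrank) 2 x = 0 ∧
        singularCohomology.map ℤ ℤ (complZero γF γE) 2 x = g := by
  set V₀ := finitePart γF γE with hV₀
  set V₁ := vectorPart γF γE with hV₁
  set a : singularCohomology ℤ ℤ ↥V₀ 2 :=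
    singularCohomology.map ℤ ℤ ((complProj γF γE).comp (subsetIncl V₀)) 2 g with ha
  obtain ⟨x, hx₀, hx₁⟩ := singularCohomology.exists_of_map_inclusion_eq ℤ (isOpen_finitePart γF γE)
    (isOpen_vectorPart γF γE) (finitePart_union_vectorPart γF γE) a 0
    ((ModuleCat.subsingleton_of_isZero isZero_singularCohomology_parts_inter).elim _ _)
  refine ⟨x, ?_, ?_⟩
  · -- `s_∞` factors through the vector part, where `x` vanishes
    set s : C(OnePoint ℂ, ↥V₁) := ⟨fun b ↦ ⟨complInf γF γE γ_finrank b, complInf_mem_vectorPart γF γE γ_finrank b⟩,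
      (complInf γF γE γ_finrank).continuous.subtype_mk _⟩ with hs
    have hc : complInf γF γE γ_finrank = (subsetIncl V₁).comp s := rfl
    rw [hc, singularCohomology.map_comp, ModuleCat.comp_apply, hx₁, map_zero]
  · -- `s₀` factors through the finite part, where `x = π^* g`
    set s : C(OnePoint ℂ, ↥V₀) := ⟨fun b ↦ ⟨complZero γF γE b, complZero_mem_finitePart γF γE b⟩,
      (complZero γF γE).continuous.subtype_mk _⟩ with hs
    have hc : complZero γF γE = (subsetIncl V₀).comp s := rfl
    have hid : ((complProj γF γE).comp (subsetIncl V₀)).comp s = ContinuousMap.id _ := rfl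
    rw [hc, singularCohomology.map_comp, ModuleCat.comp_apply, hx₀, ha, ← ModuleCat.comp_apply,
      ← singularCohomology.map_comp, hid, singularCohomology.map_id]
    rfl

/-- **Every class of `H²(P(γ¹ ⊕ ℂ); ℤ)` killed by `s_∞^*` is a multiple `t(k)` of the Thom class**
(two contractible trivialising charts of `ℂP¹`). [cite: MilnorStasheff1974, §12 Thm. 12.2] -/
theorem exists_eq_thomClass_tautological (x : singularCohomology ℤ ℤ (ProjCompl γF γE) 2)
    (hx : singularCohomology.map ℤ ℤ (complInf γF γE γ_finrank) 2 x = 0) :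
    ∃ k : ℤ, x = thomClass γF γE γ_finrank ℤ k := by
  refine exists_eq_thomClass_of_two_charts γF γE γ_finrank ℤ
    (trivializationAt γF γE ((0 : ℂ) : OnePoint ℂ)) (trivializationAt γF γE ∞)
    (U₁ := range ((↑) : ℂ → OnePoint ℂ)) (U₂ := {x : OnePoint ℂ | x ≠ ((0 : ℂ) : OnePoint ℂ)})
    (fun x hx ↦ hx) (fun x hx ↦ hx) ?_ ⟨((1 : ℂ) : OnePoint ℂ), ⟨1, rfl⟩, ?_⟩
    (isZero_singularCohomology_of_contractibleSpace ℤ ℤ _ two_ne_zero)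
    (isZero_singularCohomology_of_contractibleSpace ℤ ℤ _ two_ne_zero) x hx
  · refine eq_univ_of_forall fun x ↦ ?_
    induction x using OnePoint.rec with
    | infty => exact Or.inr (OnePoint.infty_ne_coe 0)
    | coe t => exact Or.inl ⟨t, rfl⟩
  · change ((1 : ℂ) : OnePoint ℂ) ≠ ((0 : ℂ) : OnePoint ℂ)
    rw [Ne, OnePoint.coe_eq_coe]
    exact one_ne_zero

/-- **Axiom (C₃): `c₁(γ¹)` generates `H²(ℂP¹; ℤ)`** — for the tautological line bundle over
`ℂP¹ = OnePoint ℂ`, `span_ℤ {c₁(γ¹)} = H²(ℂP¹; ℤ)` (Husemoller Ch. 17 (3.2) (C₃); Milnor–Stasheff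
Thm. 14.4 for `n = 1`). [cite: HusemollerFibreBundles1994, Ch. 17 §3 (3.2)] -/
theorem span_firstChernClass_tautological :
    Submodule.span ℤ {tautologicalLineBundle.firstChernClass rank_tautologicalLineBundle} = ⊤ := by
  refine Submodule.eq_top_iff'.2 fun g ↦ Submodule.mem_span_singleton.2 ?_
  obtain ⟨x, hxinf, hx₀⟩ := exists_map_complZero_eq g
  obtain ⟨k, hk⟩ := exists_eq_thomClass_tautological x hxinf
  refine ⟨k, ?_⟩
  rw [← hx₀, hk]
  exact (eulerClass_eq_smul γF γE γ_finrank ℤ k).symm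

end Literature.AlgebraicTopology.CharacteristicClasses
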